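import Mathlib
import HarnessLib
import Summits.ValiantsHypothesis.ValiantsHypothesis.Theses.MonotoneRestoration
import Summits.ValiantsHypothesis.ValiantsHypothesis.Theorems.MonotoneRestorationMonotoneRestorationQPSparseRegime
import Literature.Computability.AlgebraicComplexity.SymmetricOrbitCircuitEval

/-!
# F3 / BC5 WITNESS for the rung `SigmaPiSigmaRestorationQP` (crux `OrbitRestorationQP`,
stmt-ValiantsHypothesis-18293, line `depth-three-rung`)

Self-contained witness file (`Lines/DepthThreeRung_special.lean`): the graded family
`RestorationOn 𝒞` of the line skeleton `Lines/depth_three_rung.lean` (namespace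
`…Cruxes.OrbitRestorationQP.DepthThreeRung`; the definitions `IsMatrixSymmetric`, `QPOrbitRestorable`,
`RestorationOn`, `SparseClass` below are VERBATIM copies) is PROVED at the FLOOR class `SparseClass`
(polynomially many monomials, polynomial degree): `sparseRestorationQP : RestorationOn SparseClass`, from the
tree's orbit circuit `Literature.Computability.AlgebraicComplexity.OrbitCircuit.exists_symmetric_circuit_of_invariant`
(size `≤ n² + |supp|·n²·deg + 2|supp| + 1`, hence orbit `≤` size quasi-polynomial — the mechanism of the
landed floor theorems `monotoneRestorationQP_of_qpSparse` / `_of_polylogDegree`, route file §γ) and the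
arithmetic `SparseRegime.qpSparse_size_le`.

The rung of the line is the SAME family one class up the product-depth filtration:
`SigmaPiSigmaRestorationQP = RestorationOn (PDClass 1)` (polynomial-size `ΣΠΣ` circuits), whose small
representations are no longer canonical.  Why this floor lies outside the summit's known regime, in the
calibrated sense of a strengthening top: `OrbitRestorationQP` (`X`) is known ONLY on such canonical-
representation classes (sparse / polylog degree §γ, commuting scans §δ, `ζ`-closure, single bounded-
treewidth hom polynomials DPS25 Thm 1.1) — `VH` itself is trivially "known" against sparse families
(`per_n` has `n!` monomials), which is exactly why the floor and the rung are `VH`-free rungs of `X` and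
not of `VH`.

No `sorry`.
-/

set_option linter.dupNamespace false

namespace Summit.ValiantsHypothesis.ValiantsHypothesis.Cruxes.OrbitRestorationQP.DepthThreeRungSpecial

open Summit.ValiantsHypothesis.ValiantsHypothesis.Theses.MonotoneRestoration
open Literature.Computability.AlgebraicComplexity

/-- Verbatim copy (line skeleton). [folklore] -/
def IsMatrixSymmetric (f : (n : ℕ) → MvPolynomial (Fin n × Fin n) ℂ) : Prop :=
  ∀ (n : ℕ) (σ τ : Equiv.Perm (Fin n)),
    MvPolynomial.rename (fun p : Fin n × Fin n => (σ p.1, τ p.2)) (f n) = f n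

/-- Verbatim copy (line skeleton). [cite: DawarWilsenach2025, §3.3 (ORB)] -/
def QPOrbitRestorable (c n : ℕ) (p : MvPolynomial (Fin n × Fin n) ℂ) : Prop :=
  ∃ (G : Type) (_ : Fintype G) (C : LabelledArithCircuit ℂ (Fin n × Fin n) Unit G),
    C.IsSymmetric (Equiv.Perm (Fin n)) ∧ C.eval (C.output ()) = p ∧
      C.orbitSize (Equiv.Perm (Fin n)) ≤ 2 ^ ((Nat.log 2 n + c) ^ c)

/-- Verbatim copy (line skeleton). [folklore] -/
def RestorationOn (𝒞 : (n : ℕ) → ℕ → MvPolynomial (Fin n × Fin n) ℂ → Prop) : Prop :=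
  ∀ f : (n : ℕ) → MvPolynomial (Fin n × Fin n) ℂ, IsMatrixSymmetric f →
    (∃ c : ℕ, ∀ n : ℕ, 𝒞 n c (f n)) → ∃ c : ℕ, ∀ n : ℕ, QPOrbitRestorable c n (f n)

/-- Verbatim copy (line skeleton): the FLOOR class. [folklore] -/
def SparseClass (n c : ℕ) (q : MvPolynomial (Fin n × Fin n) ℂ) : Prop :=
  q.support.card ≤ n ^ c + c ∧ q.totalDegree ≤ n ^ c + c

/-- `2^m + c ≤ 2^(m + c)`. [folklore] -/
theorem two_pow_add_le (m c : ℕ) : 2 ^ m + c ≤ 2 ^ (m + c) := by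
  induction c with
  | zero => simp
  | succ c ih =>
    have h1 : 1 ≤ 2 ^ m := Nat.one_le_two_pow
    calc 2 ^ m + (c + 1) ≤ 2 * (2 ^ m + c) := by omega
      _ ≤ 2 * 2 ^ (m + c) := Nat.mul_le_mul_left 2 ih
      _ = 2 ^ (m + (c + 1)) := by ring

/-- A p-bound is a qp-bound: `n^c + c ≤ 2^((log₂ n + c₂)^c₂)` with `c₂ = 2c + 1`. [folklore] -/
theorem poly_le_qp (c : ℕ) : ∃ c₂ : ℕ, ∀ n : ℕ, n ^ c + c ≤ 2 ^ ((Nat.log 2 n + c₂) ^ c₂) := by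
  refine ⟨2 * c + 1, fun n => ?_⟩
  have hL : n < 2 ^ (Nat.log 2 n + 1) := Nat.lt_pow_succ_log_self Nat.one_lt_two n
  generalize Nat.log 2 n = L at hL ⊢
  rcases Nat.eq_zero_or_pos c with rfl | hc
  · simp [Nat.one_le_two_pow]
  · have h1 : n ^ c ≤ 2 ^ ((L + 1) * c) := by
      calc n ^ c ≤ (2 ^ (L + 1)) ^ c := Nat.pow_le_pow_left hL.le c
        _ = 2 ^ ((L + 1) * c) := (pow_mul 2 (L + 1) c).symm
    have h2 : n ^ c + c ≤ 2 ^ ((L + 1) * c + c) :=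
      (Nat.add_le_add_right h1 c).trans (two_pow_add_le _ _)
    have h3 : (L + 1) * c + c ≤ (L + (2 * c + 1)) ^ (2 * c + 1) := by
      have hB1 : 1 ≤ L + (2 * c + 1) := by omega
      calc (L + 1) * c + c = c * (L + 2) := by ring
        _ ≤ (L + (2 * c + 1)) * (L + (2 * c + 1)) := Nat.mul_le_mul (by omega) (by omega)
        _ = (L + (2 * c + 1)) ^ 2 := (sq _).symm
        _ ≤ (L + (2 * c + 1)) ^ (2 * c + 1) := Nat.pow_le_pow_right hB1 (by omega)
    exact h2.trans (Nat.pow_le_pow_right (by norm_num) h3)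

/-- **THE FLOOR OF THE PRODUCT-DEPTH LADDER IS A THEOREM**: `RestorationOn SparseClass` — every
matrix-symmetric family with polynomially many monomials of polynomial degree has square-symmetric circuits
of quasi-polynomial size, hence of quasi-polynomial orbit size (the orbit circuit). No `sorry`.
[folklore] -/
theorem sparseRestorationQP : RestorationOn SparseClass := by
  intro f hsym hcls
  obtain ⟨c, hc⟩ := hcls
  obtain ⟨c₂, hc₂⟩ := poly_le_qp c
  obtain ⟨c', hc'⟩ :=
    Summit.ValiantsHypothesis.ValiantsHypothesis.Theorems.SparseRegime.qpSparse_size_le c₂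
  refine ⟨c', fun n => ?_⟩
  have hinv : ∀ σ : Equiv.Perm (Fin n),
      MvPolynomial.rename (fun pq : Fin n × Fin n => σ • pq) (f n) = f n := fun σ => hsym n σ σ
  obtain ⟨G, inst, C, hCs, hCe, hCc⟩ := OrbitCircuit.exists_symmetric_circuit_of_invariant (f n) hinv
  refine ⟨G, inst, C, hCs, hCe, ?_⟩
  calc C.orbitSize (Equiv.Perm (Fin n)) ≤ C.size := C.orbitSize_le_size _
    _ = Fintype.card G := rfl
    _ ≤ _ := hCc
    _ ≤ 2 ^ ((Nat.log 2 n + c') ^ c') :=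
        hc' n _ _ ((hc n).1.trans (hc₂ n)) ((hc n).2.trans (hc₂ n))

/-- F3: the rung family specialises to the proved floor. [folklore] -/
example : RestorationOn SparseClass := sparseRestorationQP

/-- The floor in the polylog-DEGREE dress (route file §γ, second floor theorem): a matrix-symmetric family
of total degree `≤ (log₂ n + c)^c` is qp-orbit-restorable (it has `≤ (n²+1)^deg` monomials). No `sorry`.
[folklore] -/
theorem polylogDegreeRestorationQP :
    RestorationOn fun n c q => q.totalDegree ≤ (Nat.log 2 n + c) ^ c := by
  intro f hsym hcls
  obtain ⟨c, hc⟩ := hcls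
  obtain ⟨c₁, hc₁⟩ :=
    Summit.ValiantsHypothesis.ValiantsHypothesis.Theorems.SparseRegime.polylogDegree_sparse_le c
  obtain ⟨c', hc'⟩ :=
    Summit.ValiantsHypothesis.ValiantsHypothesis.Theorems.SparseRegime.qpSparse_size_le c₁
  refine ⟨c', fun n => ?_⟩
  have hinv : ∀ σ : Equiv.Perm (Fin n),
      MvPolynomial.rename (fun pq : Fin n × Fin n => σ • pq) (f n) = f n := fun σ => hsym n σ σ
  obtain ⟨G, inst, C, hCs, hCe, hCc⟩ := OrbitCircuit.exists_symmetric_circuit_of_invariant (f n) hinv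
  refine ⟨G, inst, C, hCs, hCe, ?_⟩
  have hS : (f n).support.card ≤ 2 ^ ((Nat.log 2 n + c₁) ^ c₁) :=
    calc (f n).support.card ≤ (Fintype.card (Fin n × Fin n) + 1) ^ (f n).totalDegree :=
          OrbitCircuit.card_support_le_of_totalDegree_le (f n) le_rfl
      _ = (n * n + 1) ^ (f n).totalDegree := by rw [Fintype.card_prod, Fintype.card_fin]
      _ ≤ 2 ^ ((Nat.log 2 n + c₁) ^ c₁) := (hc₁ n _ (hc n)).1
  calc C.orbitSize (Equiv.Perm (Fin n)) ≤ C.size := C.orbitSize_le_size _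
    _ = Fintype.card G := rfl
    _ ≤ _ := hCc
    _ ≤ 2 ^ ((Nat.log 2 n + c') ^ c') := hc' n _ _ hS (hc₁ n _ (hc n)).2

end Summit.ValiantsHypothesis.ValiantsHypothesis.Cruxes.OrbitRestorationQP.DepthThreeRungSpecial
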